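import Literature.Analysis.FluidPDE.PassiveVectorTensorTwoProblemDuality
import Literature.Analysis.FluidPDE.PassiveVectorTensorEnergyEquality
import Literature.Analysis.FunctionSpaces.TorusVectorParseval
import Literature.Analysis.FluidPDE.PassiveScalarExistenceApprox
import HarnessLib

/-!
# Two-problem duality for weak passive solenoidal vectors, PHYSICAL form: the cross terms as
# space integrals of the weak gradients (transport of the carrier difference; tensor difference
# between the two gradients)

Analysis/FluidPDE proof-support file (everything proved; no definitions, no named facts). Sequel of
`PassiveVectorTensorTwoProblemDuality`, whose `twoProblemDuality_traces` writes, for a weak solution `u`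
of problem 1 (`IsWeakTensorPassiveVectorOn 0 T 𝔸₁ b₁ u₀ u`) and a weak solution `ψ` of the ADJOINT of
problem 2 written forward in `r = t₀ − s` (`IsWeakTensorPassiveVectorOn 0 t₀ (majorTranspose 𝔸₂) (r ↦ −b₂(t₀−r)) φ ψ`),
`⟨u(t₀), φ⟩ − ⟨u₀, ψ(t₀)⟩ = ∫_{(0,t₀]} Σ'ₖ Re(−4π²⟪û(σ)(k), (T_{𝔸₁}−T_{𝔸₂})(k) ψ̂(t₀−σ)(k)⟫ + Σⱼ 2πikⱼ⟪𝓕((b₁ⱼ−b₂ⱼ)(σ) u(σ))(k), ψ̂(t₀−σ)(k)⟫) dσ`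
(MODEWISE cross terms). Here both weak solutions are `L²H¹` (`eVectorDissipation_lt_top` ⇒ space–time
`L²` weak gradients `Du`, `Dψ` with a.e. slice weak partial derivatives,
`exists_weakGradient_of_lintegral_eGradNormSq_ne_top`), and Parseval identifies the modewise density at
a.e. time with SPACE INTEGRALS:

* `Torus.hasSum_transport_pairing` — **transport pairing, Fourier ↔ physical** (generic `𝕋^d`): for
  `ψ ∈ L²` with weak partial derivatives `gⱼ ∈ L²` and scalar coefficients with `aⱼ • w ∈ L²`,
  `Σ'ₖ Σⱼ 2πikⱼ ⟪𝓕(complexify ∘ (aⱼ • w))(k), 𝓕(complexify ∘ ψ)(k)⟫_ℂ = Σⱼ ∫⟪aⱼ • w, gⱼ⟫_ℝ`;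
* `Torus.hasSum_eddy_pairing` — **eddy pairing, Fourier ↔ physical** (generic `𝕋^d`), in the
  DIVERGENCE-FORM orientation of the distorted class (`Torus.viscAdjVar`: TEST gradient in the `(c,i)`
  slots, SOLUTION gradient in the `(e,l)` slots): for `w, ψ ∈ L²` with `L²` weak partial derivatives
  `gʷ_e, g^ψ_c`, `Σ'ₖ 4π² ⟪𝓕(complexify ∘ w)(k), T_𝔸(k) 𝓕(complexify ∘ ψ)(k)⟫_ℂ = ∫ Σ_{l,i,c,e} 𝔸 i c l e (g^ψ_c)_i (gʷ_e)_l`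
  (`T_𝔸(k) z l = Σ_{i,c,e} 𝔸 i c l e k_c k_e z_i`, `symbT`; componentwise Parseval + `ĝ_c(k) = 2πik_c f̂(k)`);
* `Torus.hasSum_crossDensity_physical` — the Z1′ modewise density at one time has the sum
  `Σⱼ ∫⟪aⱼ • w, g^ψⱼ⟫ − ∫ Σ (𝔸₁−𝔸₂) i c l e (g^ψ_c)_i (gʷ_e)_l` for slices `w, ψ ∈ L²` with `L²` weak
  gradients and coefficients `aⱼ` with `aⱼ • w ∈ L²` (private `memLp_smul_of_ae_bound`: a.e.-bounded `aⱼ`);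
  `symbT_sub_tensor`;
* `IsWeakTensorPassiveVectorOn.twoProblemDuality_physical` — **the two-problem duality in physical
  form**: under the hypotheses of `twoProblemDuality_traces` VERBATIM there are space–time `L²` weak
  gradients `Du` of `u` on `(0,T)` and `Dψ` of `ψ` on `(0,t₀)` (a.e. slice weak partial derivatives) with
  `g t₀ − h t₀ = ∫_{σ ∈ (0,t₀]} ( Σⱼ ∫ ⟪(b₁ σ x j − b₂ σ x j) • u σ x, Dψ (t₀−σ) j x⟫ dx`
  `                              − ∫ Σ_{l,i,c,e} (𝔸₁ − 𝔸₂) i c l e (Dψ (t₀−σ) c x)_i (Du σ e x)_l dx ) dσ`,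
  the density and both summands being integrable on `(0,t₀)`; `twoProblemDuality_physical_split`:
  `g t₀ − h t₀ = (∫ transport cross) − (∫ viscous cross)`.
This is the `G ≡ 1` (identity frame) reading of the weak × weak Duhamel cross identity of two members
of one constraint class (cell `ad-ideate`, K1L_D `stmt-AnomalousDissipation-27980`, tenure RULING D28-25 (1):
the local pair binder `VmodDist.EnergyDuhamelG`; lead memo L24 (O3)–(O5)), and the flat half of its
instance discharge (frame reading: the Summit bricks Z6-T/Z6-E).

## Mathlib / tree search

Tree: `PassiveVectorTensorTwoProblemDuality` (`twoProblemDuality_traces`, `exists_integrableOn_hasSum_cross_sub_traces`),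
`PassiveVectorTensorEnergyEquality` (`exists_weakGradient_of_lintegral_eGradNormSq_ne_top`),
`PassiveVectorTensorDissipationBound` (`eVectorDissipation_lt_top`), `PassiveVectorTensorDuality`
(`memLp_top_stLift_reversed`), `PassiveScalarEnergyProofs` (`ae_ae_norm_le_of_memLp_top_stLift`),
`TorusVectorParseval` (`hasSum_inner_mFourierCoeff_complexify`, `hasSum_conj_mul_mFourierCoeff`, `memLp_ofReal_apply`),
`TorusSobolevNorm` (`mFourierCoeff_complexify_apply`), `PassiveVectorTensorFourier` (`symbT_apply`, `symbT_add_tensor`),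
`TorusTestFunction` (`HasWeakPartialDeriv`), `LagrangianLatticeCarrierFrameChainRule` (the coefficient lemma
`𝓕(∂ᵢf)(n) = 2πinᵢ f̂(n)` for weak derivatives, private there — copied below). The Summit-side bricks
`…LagrangianStepFrameTransport.hasSum_transport_fourier` / `…FrameEddy.hasSum_eddy_fourier` (generic `𝕋^d`
sections of lead-k1l-onelevel-p1 g4's Z6-T/Z6-E) are the models of §2; Literature cannot import Summits,
so the generic statements are re-proved here (the eddy one in the divergence-form orientation).

## References

* R. Temam, *Navier–Stokes Equations*, 3rd ed. (North-Holland 1984), Ch. III §1, Lemma 1.2 and Lemma 1.4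
  (the product rule for `⟨u, v⟩`, polarised; duality of two evolution problems). [`Temam1984`]
* S. Kuksin, A. Shirikyan, *Mathematics of two-dimensional turbulence* (CUP 2012), Prop. 2.1.7,
  (2.11)–(2.12) (the trilinear form `b(u,v,w) = Σ∫ uⱼ ∂ⱼvᵢ wᵢ`, antisymmetry). [`KuksinShirikyan2012`]
* U. Frisch, *Turbulence* (CUP 1995), §9.6.3 eq. (9.57) p. 233 (anisotropic eddy-viscosity tensor). [`Frisch1995Turbulence`]
* L. Grafakos, *Classical Fourier Analysis*, 3rd ed. (Springer 2014), Prop. 3.2.7 (Parseval/Plancherel on `𝕋^d`). [`Grafakos2014`]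
-/

noncomputable section

open MeasureTheory Set Filter Function TopologicalSpace Complex UnitAddTorus
open scoped ENNReal NNReal InnerProductSpace Topology ComplexConjugate

namespace Literature.Analysis.FluidPDE

namespace Torus

open FunctionSpaces FunctionSpaces.Torus

variable {d : Type*} [Fintype d] [DecidableEq d]

/-! ## §1 Fourier coefficients of weak derivatives (private copies, complexified) -/

section Coefficients

variable {F : Type*} [NormedAddCommGroup F] [NormedSpace ℂ F]

omit [DecidableEq d] in
/-- `∫ ψ • h = ∫ (Re ψ) • h + i ∫ (Im ψ) • h` for smooth `ψ : 𝕋^d → ℂ` and integrable `h`. [folklore]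
-- adapted from `Literature/Analysis/FluidPDE/LagrangianLatticeCarrierFrameChainRule.lean` (private there) -/
private theorem integral_smul_eq_re_add_I_smul_im₈ {ψ : UnitAddTorus d → ℂ} (hψ : IsSmooth ψ)
    {h : UnitAddTorus d → F} (hh : Integrable h volume) :
    ∫ x, ψ x • h x = (∫ x, (ψ x).re • h x) + Complex.I • ∫ x, (ψ x).im • h x := by
  have hre : IsSmooth fun x => (ψ x).re := hψ.comp_clm Complex.reCLM
  have him : IsSmooth fun x => (ψ x).im := hψ.comp_clm Complex.imCLM
  have h2i : Integrable (fun x => Complex.I • ((ψ x).im • h x)) volume :=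
    (him.integrable_smul hh).smul Complex.I
  rw [← integral_smul, ← integral_add (hre.integrable_smul hh) h2i]
  refine integral_congr_ae (ae_of_all _ fun x => ?_)
  beta_reduce
  calc ψ x • h x = (((ψ x).re : ℂ) + ((ψ x).im : ℂ) * Complex.I) • h x := by rw [Complex.re_add_im]
    _ = ((ψ x).re : ℂ) • h x + Complex.I • (((ψ x).im : ℂ) • h x) := by
        rw [add_smul, mul_comm, mul_smul]
    _ = (ψ x).re • h x + Complex.I • ((ψ x).im • h x) := by
        rw [Complex.coe_smul, Complex.coe_smul]

/-- `ĝ(n) = 2πi nᵢ f̂(n)` for a weak `i`-th partial derivative `g` of `f` (both integrable, complex values): test the weak identity with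
`Re e_{-n}`, `Im e_{-n}`. [folklore]
-- adapted from `Literature/Analysis/FluidPDE/LagrangianLatticeCarrierFrameChainRule.lean` (private there) -/
private theorem mFourierCoeff_eq_of_hasWeakPartialDeriv₈ {i : d} {f g : UnitAddTorus d → F}
    (hf : Integrable f volume) (hg : Integrable g volume) (h : FunctionSpaces.Torus.HasWeakPartialDeriv i f g)
    (n : d → ℤ) :
    mFourierCoeff g n = (2 * Real.pi * Complex.I * (n i)) • mFourierCoeff f n := by
  have hχ : IsSmooth (⇑(mFourier (-n)) : UnitAddTorus d → ℂ) := isSmooth_mFourier (-n)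
  have hre : IsSmooth fun y => (mFourier (-n) y).re := hχ.comp_clm Complex.reCLM
  have him : IsSmooth fun y => (mFourier (-n) y).im := hχ.comp_clm Complex.imCLM
  set c : ℂ := 2 * Real.pi * Complex.I * ((-n) i) with hc
  have hcχ : IsSmooth (fun x => c * mFourier (-n) x) := contDiff_const.mul hχ
  have hdre : ∀ x, FunctionSpaces.Torus.partialDeriv i (fun y => (mFourier (-n) y).re) x = (c * mFourier (-n) x).re :=
    fun x => by
    have h1 := partialDeriv_clm_comp hχ Complex.reCLM i x
    rw [partialDeriv_mFourier] at h1
    exact h1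
  have hdim : ∀ x, FunctionSpaces.Torus.partialDeriv i (fun y => (mFourier (-n) y).im) x = (c * mFourier (-n) x).im :=
    fun x => by
    have h1 := partialDeriv_clm_comp hχ Complex.imCLM i x
    rw [partialDeriv_mFourier] at h1
    exact h1
  have h1 := h (fun y => (mFourier (-n) y).re) hre
  have h2 := h (fun y => (mFourier (-n) y).im) him
  beta_reduce at h1 h2
  simp_rw [hdre] at h1
  simp_rw [hdim] at h2
  have h1' : ∫ x, (mFourier (-n) x).re • g x = -∫ x, (c * mFourier (-n) x).re • f x := by
    rw [h1, neg_neg]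
  have h2' : ∫ x, (mFourier (-n) x).im • g x = -∫ x, (c * mFourier (-n) x).im • f x := by
    rw [h2, neg_neg]
  calc mFourierCoeff g n = ∫ x, mFourier (-n) x • g x := mFourierCoeff_eq_integral_volume g n
    _ = (∫ x, (mFourier (-n) x).re • g x) + Complex.I • ∫ x, (mFourier (-n) x).im • g x :=
        integral_smul_eq_re_add_I_smul_im₈ hχ hg
    _ = -((∫ x, (c * mFourier (-n) x).re • f x) +
          Complex.I • ∫ x, (c * mFourier (-n) x).im • f x) := by
        rw [h1', h2', smul_neg, neg_add]
    _ = -∫ x, (c * mFourier (-n) x) • f x := by rw [integral_smul_eq_re_add_I_smul_im₈ hcχ hf]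
    _ = -(c • mFourierCoeff f n) := by
        rw [mFourierCoeff_eq_integral_volume, ← integral_smul]
        congr 1
        refine integral_congr_ae (ae_of_all _ fun x => ?_)
        simp only [smul_smul]
    _ = (2 * Real.pi * Complex.I * (n i)) • mFourierCoeff f n := by
        rw [← neg_smul]
        congr 1
        simp only [hc, Pi.neg_apply, Int.cast_neg]
        ring

/-- Complexification of a weak derivative of a real vector field. [folklore]
-- adapted from `Literature/Analysis/FluidPDE/LagrangianLatticeCarrierFrameChainRule.lean` (private there) -/
private theorem hasWeakPartialDeriv_complexify₈ {i : d} {f g : UnitAddTorus d → EuclideanSpace ℝ d}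
    (h : FunctionSpaces.Torus.HasWeakPartialDeriv i f g) :
    FunctionSpaces.Torus.HasWeakPartialDeriv i (EuclideanSpace.complexify ∘ f) (EuclideanSpace.complexify ∘ g) := by
  intro φ hφ
  have e1 : (fun x => FunctionSpaces.Torus.partialDeriv i φ x • (EuclideanSpace.complexify ∘ f) x) =
      fun x => EuclideanSpace.complexify (FunctionSpaces.Torus.partialDeriv i φ x • f x) := by
    funext x
    simp only [Function.comp_apply, map_smul]
  have e2 : (fun x => φ x • (EuclideanSpace.complexify ∘ g) x) =
      fun x => EuclideanSpace.complexify (φ x • g x) := by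
    funext x
    simp only [Function.comp_apply, map_smul]
  rw [e1, e2, LinearIsometry.integral_comp_comm, LinearIsometry.integral_comp_comm, h φ hφ, map_neg]

/-- `𝓕(complexify ∘ g)(n) = 2πi nᵢ 𝓕(complexify ∘ f)(n)` for a weak `i`-th partial derivative `g` of a real vector field `f`. [folklore]
-- adapted from `Literature/Analysis/FluidPDE/LagrangianLatticeCarrierFrameChainRule.lean` (private there) -/
private theorem mFourierCoeff_complexify_eq_of_hasWeakPartialDeriv₈ {i : d}
    {f g : UnitAddTorus d → EuclideanSpace ℝ d} (hf : Integrable f volume) (hg : Integrable g volume)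
    (h : FunctionSpaces.Torus.HasWeakPartialDeriv i f g) (n : d → ℤ) :
    mFourierCoeff (EuclideanSpace.complexify ∘ g) n =
      (2 * Real.pi * Complex.I * (n i)) • mFourierCoeff (EuclideanSpace.complexify ∘ f) n := by
  have hf' : Integrable (EuclideanSpace.complexify ∘ f) volume :=
    EuclideanSpace.complexify.toContinuousLinearMap.integrable_comp hf
  have hg' : Integrable (EuclideanSpace.complexify ∘ g) volume :=
    EuclideanSpace.complexify.toContinuousLinearMap.integrable_comp hg
  exact mFourierCoeff_eq_of_hasWeakPartialDeriv₈ hf' hg' (hasWeakPartialDeriv_complexify₈ h) n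

/-- Components: `𝓕(complexify ∘ g)(n)ⱼ = 2πi nᵢ · 𝓕(complexify ∘ f)(n)ⱼ`. [folklore] -/
private theorem mFourierCoeff_complexify_apply_eq_of_hasWeakPartialDeriv₈ {i : d}
    {f g : UnitAddTorus d → EuclideanSpace ℝ d} (hf : Integrable f volume) (hg : Integrable g volume)
    (h : FunctionSpaces.Torus.HasWeakPartialDeriv i f g) (n : d → ℤ) (j : d) :
    (mFourierCoeff (EuclideanSpace.complexify ∘ g) n) j =
      (2 * Real.pi * Complex.I * (n i)) * (mFourierCoeff (EuclideanSpace.complexify ∘ f) n) j := by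
  rw [mFourierCoeff_complexify_eq_of_hasWeakPartialDeriv₈ hf hg h n, PiLp.smul_apply, smul_eq_mul]

end Coefficients

/-! ## §2 The two cross pairings: Fourier form ↔ physical form (generic `𝕋^d`) -/

section Pairings

omit [DecidableEq d] in
/-- A coefficient that is a.e. bounded keeps a vector field in `L²`: `a • w ∈ L²` for measurable `a` with
`|a| ≤ M` a.e. and `w ∈ L²`. [folklore] -/
private theorem memLp_smul_of_ae_bound {a : UnitAddTorus d → ℝ} {w : UnitAddTorus d → EuclideanSpace ℝ d}
    (ha : AEStronglyMeasurable a volume) {M : ℝ} (haM : ∀ᵐ x ∂volume, |a x| ≤ M) (hw : MemLp w 2 volume) :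
    MemLp (fun z => a z • w z) 2 volume := by
  refine MemLp.of_le_mul (c := M) hw (ha.smul hw.1) ?_
  filter_upwards [haM] with x hx
  rw [norm_smul, Real.norm_eq_abs]
  exact mul_le_mul_of_nonneg_right hx (norm_nonneg _)

/-- **The transport pairing, Fourier ↔ physical** (Parseval + `ĝⱼ(k) = 2πikⱼ ψ̂(k)`): for
`ψ ∈ L²(𝕋^d; ℝ^d)` with weak partial derivatives `gⱼ ∈ L²` and scalar coefficients `aⱼ` with
`aⱼ • w ∈ L²` (`j ∈ d`),
`Σ'ₖ Σⱼ 2πikⱼ ⟪𝓕(complexify ∘ (aⱼ • w))(k), 𝓕(complexify ∘ ψ)(k)⟫_ℂ = Σⱼ ∫ ⟪aⱼ • w, gⱼ⟫_ℝ` (as a `HasSum` in `ℂ`)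
— the flux `Σⱼ ∫ uᵢ aⱼ ∂ⱼψᵢ` of the trilinear form with the derivative on the test.
[cite: KuksinShirikyan2012, Prop. 2.1.7 (2.11)–(2.12)] [cite: Grafakos2014, Prop. 3.2.7] -/
theorem hasSum_transport_pairing {a : d → UnitAddTorus d → ℝ} {w ψ : UnitAddTorus d → EuclideanSpace ℝ d}
    {g : d → UnitAddTorus d → EuclideanSpace ℝ d}
    (haw : ∀ j, MemLp (fun z => a j z • w z) 2 volume) (hψ : MemLp ψ 2 volume) (hg : ∀ j, MemLp (g j) 2 volume)
    (hwd : ∀ j, FunctionSpaces.Torus.HasWeakPartialDeriv j ψ (g j)) :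
    HasSum (fun k' : d → ℤ => ∑ j, (2 * Real.pi * Complex.I * (k' j)) *
        ⟪mFourierCoeff (EuclideanSpace.complexify ∘ fun z => a j z • w z) k', mFourierCoeff (EuclideanSpace.complexify ∘ ψ) k'⟫_ℂ)
      (((∑ j, ∫ x, ⟪a j x • w x, g j x⟫_ℝ : ℝ) : ℂ)) := by
  have hψi : Integrable ψ volume := hψ.integrable one_le_two
  have hcoef : ∀ j (k' : d → ℤ), mFourierCoeff (EuclideanSpace.complexify ∘ g j) k' =
      (2 * Real.pi * Complex.I * (k' j)) • mFourierCoeff (EuclideanSpace.complexify ∘ ψ) k' := fun j k' =>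
    mFourierCoeff_complexify_eq_of_hasWeakPartialDeriv₈ hψi ((hg j).integrable one_le_two) (hwd j) k'
  have hj : ∀ j, HasSum (fun k' : d → ℤ => (2 * Real.pi * Complex.I * (k' j)) *
      ⟪mFourierCoeff (EuclideanSpace.complexify ∘ fun z => a j z • w z) k', mFourierCoeff (EuclideanSpace.complexify ∘ ψ) k'⟫_ℂ)
      ((∫ x, ⟪a j x • w x, g j x⟫_ℝ : ℝ) : ℂ) := by
    intro j
    have h := hasSum_inner_mFourierCoeff_complexify (haw j) (hg j)
    have e : (fun k' : d → ℤ => (2 * Real.pi * Complex.I * (k' j)) *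
        ⟪mFourierCoeff (EuclideanSpace.complexify ∘ fun z => a j z • w z) k', mFourierCoeff (EuclideanSpace.complexify ∘ ψ) k'⟫_ℂ) =
        fun k' => ⟪mFourierCoeff (EuclideanSpace.complexify ∘ fun z => a j z • w z) k',
          mFourierCoeff (EuclideanSpace.complexify ∘ g j) k'⟫_ℂ := by
      funext k'
      rw [hcoef j k', inner_smul_right]
    rw [e]
    exact h
  have := hasSum_sum (s := Finset.univ) fun j _ => hj j
  push_cast
  exact this

omit [DecidableEq d] in
/-- The algebra at one frequency, divergence-form orientation: with `Gʷ_{e l} = 2πik_e Xₗ` (solution) and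
`G^ψ_{c i} = 2πik_c Yᵢ` (test), `4π² ⟪X, T_𝔸(k) Y⟫_ℂ = Σ_{l i c e} 𝔸 i c l e · conj(Gʷ_{e l}) · G^ψ_{c i}`. [folklore] -/
private theorem eddy_termwise₈ (𝔸 : Visc4 d) (k : d → ℤ) (X Y : EuclideanSpace ℂ d) (Gw Gψ : d → EuclideanSpace ℂ d)
    (hGw : ∀ e l, Gw e l = (2 * Real.pi * Complex.I * (k e)) * X l)
    (hGψ : ∀ c i, Gψ c i = (2 * Real.pi * Complex.I * (k c)) * Y i) :
    ((4 * Real.pi ^ 2 : ℝ) : ℂ) * ⟪X, symbT 𝔸 k Y⟫_ℂ =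
      ∑ l, ∑ i, ∑ c, ∑ e, (𝔸 i c l e : ℂ) * (starRingEnd ℂ (Gw e l) * Gψ c i) := by
  have hterm : ∀ l i c e, (𝔸 i c l e : ℂ) * (starRingEnd ℂ (Gw e l) * Gψ c i) =
      ((4 * Real.pi ^ 2 : ℝ) : ℂ) * (starRingEnd ℂ (X l) * (((𝔸 i c l e * (k c : ℝ) * (k e : ℝ) : ℝ) : ℂ) * Y i)) := by
    intro l i c e
    rw [hGw, hGψ]
    simp only [map_mul, Complex.conj_I, Complex.conj_ofReal, map_intCast, map_ofNat]
    push_cast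
    linear_combination (-((𝔸 i c l e : ℂ) * (Real.pi : ℂ) ^ 2 * (k e : ℂ) * starRingEnd ℂ (X l) * (k c : ℂ) * Y i * 4)) * Complex.I_sq
  simp_rw [hterm]
  simp only [PiLp.inner_apply, RCLike.inner_apply', symbT_apply, Finset.mul_sum]

/-- **The eddy pairing, Fourier ↔ physical, divergence-form orientation** (componentwise Parseval +
`ĝ_c(k) = 2πik_c f̂(k)`): for `w, ψ ∈ L²(𝕋^d; ℝ^d)` with weak partial derivatives `gʷ_e, g^ψ_c ∈ L²`,
`Σ'ₖ 4π² ⟪𝓕(complexify ∘ w)(k), T_𝔸(k) 𝓕(complexify ∘ ψ)(k)⟫_ℂ = ∫ Σ_{l,i,c,e} 𝔸 i c l e (g^ψ_c x)_i (gʷ_e x)_l dx`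
(as a `HasSum` in `ℂ`): the TEST gradient in the `(c,i)` slots and the SOLUTION gradient in the `(e,l)`
slots of the tensor, i.e. the energy form `∫ Σ 𝔸_{icle} (∂_cψ)_i (∂_e w)_l` of the divergence-form operator
`(𝓛^*_𝔸 ψ)_l = Σ ∂_e(𝔸_{icle} ∂_c ψ_i)` paired with `w` (the constant-coefficient case of Giaquinta's form;
Frisch's eddy-viscosity tensor). [cite: Frisch1995Turbulence, §9.6.3 eq. (9.57) p. 233] [cite: Grafakos2014, Prop. 3.2.7] -/
theorem hasSum_eddy_pairing (𝔸 : Visc4 d) {w ψ : UnitAddTorus d → EuclideanSpace ℝ d} {gw gψ : d → UnitAddTorus d → EuclideanSpace ℝ d}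
    (hw : MemLp w 2 volume) (hψ : MemLp ψ 2 volume) (hgw : ∀ a, MemLp (gw a) 2 volume) (hgψ : ∀ a, MemLp (gψ a) 2 volume)
    (hdw : ∀ a, FunctionSpaces.Torus.HasWeakPartialDeriv a w (gw a)) (hdψ : ∀ a, FunctionSpaces.Torus.HasWeakPartialDeriv a ψ (gψ a)) :
    HasSum (fun k : d → ℤ => ((4 * Real.pi ^ 2 : ℝ) : ℂ) *
        ⟪mFourierCoeff (EuclideanSpace.complexify ∘ w) k, symbT 𝔸 k (mFourierCoeff (EuclideanSpace.complexify ∘ ψ) k)⟫_ℂ)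
      (((∫ x, ∑ l, ∑ i, ∑ c, ∑ e, 𝔸 i c l e * (gψ c x) i * (gw e x) l : ℝ) : ℂ)) := by
  have hwi : Integrable w volume := hw.integrable one_le_two
  have hψi : Integrable ψ volume := hψ.integrable one_le_two
  have hgwi : ∀ a, Integrable (gw a) volume := fun a => (hgw a).integrable one_le_two
  have hgψi : ∀ a, Integrable (gψ a) volume := fun a => (hgψ a).integrable one_le_two
  have hGw : ∀ k e l, (mFourierCoeff (EuclideanSpace.complexify ∘ gw e) k) l =
      (2 * Real.pi * Complex.I * (k e)) * (mFourierCoeff (EuclideanSpace.complexify ∘ w) k) l := fun k e l =>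
    mFourierCoeff_complexify_apply_eq_of_hasWeakPartialDeriv₈ hwi (hgwi e) (hdw e) k l
  have hGψ : ∀ k c i, (mFourierCoeff (EuclideanSpace.complexify ∘ gψ c) k) i =
      (2 * Real.pi * Complex.I * (k c)) * (mFourierCoeff (EuclideanSpace.complexify ∘ ψ) k) i := fun k c i =>
    mFourierCoeff_complexify_apply_eq_of_hasWeakPartialDeriv₈ hψi (hgψi c) (hdψ c) k i
  -- componentwise Parseval
  have hP : ∀ l i c e, HasSum (fun k : d → ℤ => (𝔸 i c l e : ℂ) *
      (starRingEnd ℂ ((mFourierCoeff (EuclideanSpace.complexify ∘ gw e) k) l) * (mFourierCoeff (EuclideanSpace.complexify ∘ gψ c) k) i))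
      ((𝔸 i c l e : ℂ) * ∫ x, starRingEnd ℂ (((gw e x) l : ℝ) : ℂ) * (((gψ c x) i : ℝ) : ℂ)) := by
    intro l i c e
    have h := (hasSum_conj_mul_mFourierCoeff (memLp_ofReal_apply (hgw e) l) (memLp_ofReal_apply (hgψ c) i)).mul_left (𝔸 i c l e : ℂ)
    simp_rw [mFourierCoeff_complexify_apply (hgwi e), mFourierCoeff_complexify_apply (hgψi c)]
    exact h
  have e : (fun k : d → ℤ => ((4 * Real.pi ^ 2 : ℝ) : ℂ) *
        ⟪mFourierCoeff (EuclideanSpace.complexify ∘ w) k, symbT 𝔸 k (mFourierCoeff (EuclideanSpace.complexify ∘ ψ) k)⟫_ℂ) =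
      fun k => ∑ l, ∑ i, ∑ c, ∑ e, (𝔸 i c l e : ℂ) *
        (starRingEnd ℂ ((mFourierCoeff (EuclideanSpace.complexify ∘ gw e) k) l) *
          (mFourierCoeff (EuclideanSpace.complexify ∘ gψ c) k) i) :=
    funext fun k => eddy_termwise₈ 𝔸 k _ _ (fun e => mFourierCoeff (EuclideanSpace.complexify ∘ gw e) k)
      (fun c => mFourierCoeff (EuclideanSpace.complexify ∘ gψ c) k) (fun e l => hGw k e l) (fun c i => hGψ k c i)
  -- the physical value: exchange the finite sums and the integral
  have hint : ∀ l i c e, Integrable (fun x => 𝔸 i c l e * (gψ c x) i * (gw e x) l) volume := by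
    intro l i c e
    have h := (((hgψ c).eval_piLp i).integrable_mul ((hgw e).eval_piLp l)).const_mul (𝔸 i c l e)
    refine h.congr (ae_of_all _ fun x => ?_)
    simp only [Pi.mul_apply]
    ring
  have hR1 : ∫ x, ∑ l, ∑ i, ∑ c, ∑ e, 𝔸 i c l e * (gψ c x) i * (gw e x) l =
      ∑ l, ∑ i, ∑ c, ∑ e, ∫ x, 𝔸 i c l e * (gψ c x) i * (gw e x) l := by
    rw [integral_finsetSum _ (fun l _ => integrable_finsetSum _ fun i _ => integrable_finsetSum _ fun c _ =>
      integrable_finsetSum _ fun e _ => hint l i c e)]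
    refine Finset.sum_congr rfl fun l _ => ?_
    rw [integral_finsetSum _ (fun i _ => integrable_finsetSum _ fun c _ => integrable_finsetSum _ fun e _ => hint l i c e)]
    refine Finset.sum_congr rfl fun i _ => ?_
    rw [integral_finsetSum _ (fun c _ => integrable_finsetSum _ fun e _ => hint l i c e)]
    refine Finset.sum_congr rfl fun c _ => ?_
    rw [integral_finsetSum _ (fun e _ => hint l i c e)]
  have hR : (((∫ x, ∑ l, ∑ i, ∑ c, ∑ e, 𝔸 i c l e * (gψ c x) i * (gw e x) l : ℝ) : ℂ)) =
      ∑ l, ∑ i, ∑ c, ∑ e, (𝔸 i c l e : ℂ) * ∫ x, starRingEnd ℂ (((gw e x) l : ℝ) : ℂ) * (((gψ c x) i : ℝ) : ℂ) := by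
    rw [hR1]
    push_cast
    refine Finset.sum_congr rfl fun l _ => Finset.sum_congr rfl fun i _ => Finset.sum_congr rfl fun c _ =>
      Finset.sum_congr rfl fun e _ => ?_
    have e1 : ∫ x, 𝔸 i c l e * (gψ c x) i * (gw e x) l = 𝔸 i c l e * ∫ x, (gψ c x) i * (gw e x) l := by
      rw [← integral_const_mul]
      refine integral_congr_ae (ae_of_all _ fun x => ?_)
      ring
    rw [e1]
    push_cast
    congr 1
    rw [← integral_complex_ofReal]
    refine integral_congr_ae (ae_of_all _ fun x => ?_)
    simp only [Complex.ofReal_mul, Complex.conj_ofReal]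
    ring
  rw [e, hR]
  exact hasSum_sum fun l _ => hasSum_sum fun i _ => hasSum_sum fun c _ => hasSum_sum fun e _ => hP l i c e

omit [DecidableEq d] in
/-- `T_{𝔸₁}(k) z − T_{𝔸₂}(k) z = T_{𝔸₁ − 𝔸₂}(k) z` (the symbol is additive in the tensor). [cite: Frisch1995Turbulence, §9.6.3 eq. (9.57) p. 233] -/
theorem symbT_sub_tensor (𝔸₁ 𝔸₂ : Visc4 d) (k : d → ℤ) (z : EuclideanSpace ℂ d) :
    symbT 𝔸₁ k z - symbT 𝔸₂ k z = symbT (𝔸₁ - 𝔸₂) k z := by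
  rw [sub_eq_iff_eq_add, ← symbT_add_tensor, sub_add_cancel]

/-- **The Z1′ cross density at one time, PHYSICAL form.** For slices `w, ψ ∈ L²` with `L²` weak partial
derivatives `gʷ`, `g^ψ` and scalar coefficients `aⱼ` with `aⱼ • w ∈ L²`,
`Σ'ₖ Re(−4π²⟪ŵ(k), (T_{𝔸₁}(k) − T_{𝔸₂}(k)) ψ̂(k)⟫ + Σⱼ 2πikⱼ ⟪𝓕(aⱼ • w)(k), ψ̂(k)⟫)`
`  = Σⱼ ∫⟪aⱼ • w, g^ψⱼ⟫ − ∫ Σ_{l,i,c,e} (𝔸₁ − 𝔸₂) i c l e (g^ψ_c)_i (gʷ_e)_l`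
(and the modewise family has this sum). [cite: Temam1984, Ch. III §1 Lemma 1.2 and Lemma 1.4] [cite: Grafakos2014, Prop. 3.2.7] -/
theorem hasSum_crossDensity_physical (𝔸₁ 𝔸₂ : Visc4 d) {a : d → UnitAddTorus d → ℝ}
    {w ψ : UnitAddTorus d → EuclideanSpace ℝ d} {gw gψ : d → UnitAddTorus d → EuclideanSpace ℝ d}
    (hw : MemLp w 2 volume) (hψ : MemLp ψ 2 volume) (hgw : ∀ c, MemLp (gw c) 2 volume) (hgψ : ∀ c, MemLp (gψ c) 2 volume)
    (hdw : ∀ c, FunctionSpaces.Torus.HasWeakPartialDeriv c w (gw c)) (hdψ : ∀ c, FunctionSpaces.Torus.HasWeakPartialDeriv c ψ (gψ c))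
    (haw : ∀ j, MemLp (fun z => a j z • w z) 2 volume) :
    HasSum (fun k : d → ℤ =>
        ((-(4 * Real.pi ^ 2 : ℝ) : ℂ) *
            ⟪mFourierCoeff (EuclideanSpace.complexify ∘ w) k,
              symbT 𝔸₁ k (mFourierCoeff (EuclideanSpace.complexify ∘ ψ) k)
                - symbT 𝔸₂ k (mFourierCoeff (EuclideanSpace.complexify ∘ ψ) k)⟫_ℂ +
          ∑ j, (2 * Real.pi * I * (k j)) *
            ⟪mFourierCoeff (EuclideanSpace.complexify ∘ fun x => a j x • w x) k,
                mFourierCoeff (EuclideanSpace.complexify ∘ ψ) k⟫_ℂ).re)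
      ((∑ j, ∫ x, ⟪a j x • w x, gψ j x⟫_ℝ) -
        ∫ x, ∑ l, ∑ i, ∑ c, ∑ e, (𝔸₁ - 𝔸₂) i c l e * (gψ c x) i * (gw e x) l) := by
  have hE := hasSum_eddy_pairing (𝔸₁ - 𝔸₂) hw hψ hgw hgψ hdw hdψ
  have hT := hasSum_transport_pairing haw hψ hgψ hdψ
  have hC := hE.neg.add hT
  have hre := Complex.reCLM.hasSum hC
  have e : ∀ k : d → ℤ,
      Complex.reCLM (-(((4 * Real.pi ^ 2 : ℝ) : ℂ) *
            ⟪mFourierCoeff (EuclideanSpace.complexify ∘ w) k,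
              symbT (𝔸₁ - 𝔸₂) k (mFourierCoeff (EuclideanSpace.complexify ∘ ψ) k)⟫_ℂ) +
          ∑ j, (2 * Real.pi * Complex.I * (k j)) *
            ⟪mFourierCoeff (EuclideanSpace.complexify ∘ fun z => a j z • w z) k,
              mFourierCoeff (EuclideanSpace.complexify ∘ ψ) k⟫_ℂ) =
        ((-(4 * Real.pi ^ 2 : ℝ) : ℂ) *
            ⟪mFourierCoeff (EuclideanSpace.complexify ∘ w) k,
              symbT 𝔸₁ k (mFourierCoeff (EuclideanSpace.complexify ∘ ψ) k)
                - symbT 𝔸₂ k (mFourierCoeff (EuclideanSpace.complexify ∘ ψ) k)⟫_ℂ +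
          ∑ j, (2 * Real.pi * I * (k j)) *
            ⟪mFourierCoeff (EuclideanSpace.complexify ∘ fun x => a j x • w x) k,
                mFourierCoeff (EuclideanSpace.complexify ∘ ψ) k⟫_ℂ).re := by
    intro k
    rw [Complex.reCLM_apply, symbT_sub_tensor, neg_mul]
  have e' : Complex.reCLM (-(((∫ x, ∑ l, ∑ i, ∑ c, ∑ e, (𝔸₁ - 𝔸₂) i c l e * (gψ c x) i * (gw e x) l : ℝ) : ℂ)) +
        (((∑ j, ∫ x, ⟪a j x • w x, gψ j x⟫_ℝ : ℝ) : ℂ))) =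
      (∑ j, ∫ x, ⟪a j x • w x, gψ j x⟫_ℝ) -
        ∫ x, ∑ l, ∑ i, ∑ c, ∑ e, (𝔸₁ - 𝔸₂) i c l e * (gψ c x) i * (gw e x) l := by
    rw [Complex.reCLM_apply, ← Complex.ofReal_neg, ← Complex.ofReal_add, Complex.ofReal_re]
    ring
  rw [e'] at hre
  have hfun : (fun k : d → ℤ =>
        ((-(4 * Real.pi ^ 2 : ℝ) : ℂ) *
            ⟪mFourierCoeff (EuclideanSpace.complexify ∘ w) k,
              symbT 𝔸₁ k (mFourierCoeff (EuclideanSpace.complexify ∘ ψ) k)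
                - symbT 𝔸₂ k (mFourierCoeff (EuclideanSpace.complexify ∘ ψ) k)⟫_ℂ +
          ∑ j, (2 * Real.pi * I * (k j)) *
            ⟪mFourierCoeff (EuclideanSpace.complexify ∘ fun x => a j x • w x) k,
                mFourierCoeff (EuclideanSpace.complexify ∘ ψ) k⟫_ℂ).re) =
      fun k => Complex.reCLM (-(((4 * Real.pi ^ 2 : ℝ) : ℂ) *
            ⟪mFourierCoeff (EuclideanSpace.complexify ∘ w) k,
              symbT (𝔸₁ - 𝔸₂) k (mFourierCoeff (EuclideanSpace.complexify ∘ ψ) k)⟫_ℂ) +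
          ∑ j, (2 * Real.pi * Complex.I * (k j)) *
            ⟪mFourierCoeff (EuclideanSpace.complexify ∘ fun z => a j z • w z) k,
              mFourierCoeff (EuclideanSpace.complexify ∘ ψ) k⟫_ℂ) := funext fun k => (e k).symm
  rw [hfun]
  exact hre

end Pairings

/-! ## §3 Measure-theoretic bookkeeping: slices of space–time `L²` gradients, time reversal -/

section Slices

omit [Fintype d] [DecidableEq d] in
/-- Slices of an `L²` function on a product are a.e. in `L²`. [folklore]
-- adapted from `Literature/Analysis/FluidPDE/NSGaldiVorticityL2.lean` (`ae_memLp_slice_of_memLp_prod`) -/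
private theorem ae_memLp_two_slice_of_memLp_prod₈ {X Y : Type*} [MeasurableSpace X] [MeasurableSpace Y]
    {μ : Measure X} {κ : Measure Y} [SFinite μ] [SFinite κ] {G : Type*} [NormedAddCommGroup G]
    {f : X × Y → G} (hf : MemLp f 2 (μ.prod κ)) :
    ∀ᵐ x ∂μ, MemLp (fun y => f (x, y)) 2 κ := by
  have hslice : ∀ᵐ x ∂μ, AEStronglyMeasurable (fun y => f (x, y)) κ := hf.1.prodMk_left
  have hfin := lintegral_rpow_enorm_lt_top_of_eLpNorm_lt_top two_ne_zero ENNReal.ofNat_ne_top hf.2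
  rw [lintegral_prod _ (hf.1.enorm.pow_const _)] at hfin
  have hint : AEMeasurable (fun x => ∫⁻ y, ‖f (x, y)‖ₑ ^ (2 : ℝ≥0∞).toReal ∂κ) μ :=
    (hf.1.enorm.pow_const _).lintegral_prod_right'
  have hfin' : ∀ᵐ x ∂μ, ∫⁻ y, ‖f (x, y)‖ₑ ^ (2 : ℝ≥0∞).toReal ∂κ < ⊤ := ae_lt_top' hint hfin.ne
  filter_upwards [hslice, hfin'] with x h1 h2
  exact ⟨h1, (eLpNorm_lt_top_iff_lintegral_rpow_enorm_lt_top two_ne_zero ENNReal.ofNat_ne_top).2 h2⟩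

omit [Fintype d] [DecidableEq d] in
/-- A.e. statements on `(0,t₀)` are invariant under the reflection `σ ↦ t₀ − σ`. [folklore] -/
private theorem ae_restrict_Ioo_reflect₈ {t₀ : ℝ} {P : ℝ → Prop}
    (h : ∀ᵐ r ∂((volume : Measure ℝ).restrict (Ioo 0 t₀)), P r) :
    ∀ᵐ σ ∂((volume : Measure ℝ).restrict (Ioo 0 t₀)), P (t₀ - σ) := by
  have h' : ∀ᵐ r ∂(volume : Measure ℝ), r ∈ Ioo 0 t₀ → P r := (ae_restrict_iff' measurableSet_Ioo).1 h
  have h'' : ∀ᵐ σ ∂(volume : Measure ℝ), (t₀ - σ) ∈ Ioo 0 t₀ → P (t₀ - σ) :=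
    (Measure.measurePreserving_sub_left volume t₀).quasiMeasurePreserving.ae h'
  rw [ae_restrict_iff' measurableSet_Ioo]
  filter_upwards [h''] with σ hσ hσI
  exact hσ ⟨by linarith [hσI.2], by linarith [hσI.1]⟩

omit [DecidableEq d] in
/-- The slab measure `(vol|_(0,S)) ⊗ vol` is monotone in the time window. [folklore] -/
private theorem slab_le_slab₈ {t₀ T : ℝ} (h : Ioo 0 t₀ ⊆ Ioo 0 T) :
    ((volume : Measure ℝ).restrict (Ioo 0 t₀)).prod (volume : Measure (UnitAddTorus d)) ≤
      ((volume : Measure ℝ).restrict (Ioo 0 T)).prod (volume : Measure (UnitAddTorus d)) :=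
  Measure.prod_mono (Measure.restrict_mono h le_rfl) le_rfl

omit [DecidableEq d] in
/-- The reflection `(σ, x) ↦ (t₀ − σ, x)` preserves the slab measure on `(0,t₀) × 𝕋^d`. [folklore] -/
private theorem measurePreserving_reflect_slab₈ (t₀ : ℝ) :
    MeasurePreserving (fun p : ℝ × UnitAddTorus d => (t₀ - p.1, p.2))
      (((volume : Measure ℝ).restrict (Ioo 0 t₀)).prod volume) (((volume : Measure ℝ).restrict (Ioo 0 t₀)).prod volume) := by
  have hpre : (fun s : ℝ => t₀ - s) ⁻¹' Ioo 0 t₀ = Ioo 0 t₀ := by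
    ext s
    simp only [mem_preimage, mem_Ioo]
    constructor <;> intro hs <;> constructor <;> linarith [hs.1, hs.2]
  have h1 : MeasurePreserving (fun s : ℝ => t₀ - s) ((volume : Measure ℝ).restrict (Ioo 0 t₀))
      ((volume : Measure ℝ).restrict (Ioo 0 t₀)) := by
    have h := (Measure.measurePreserving_sub_left (volume : Measure ℝ) t₀).restrict_preimage
      (measurableSet_Ioo (a := (0 : ℝ)) (b := t₀))
    rwa [hpre] at h
  exact h1.prod (MeasurePreserving.id (volume : Measure (UnitAddTorus d)))

omit [DecidableEq d] in
/-- Time reflection keeps a field in `L^p` of the slab: `(σ, x) ↦ F (t₀ − σ) x`. [folklore] -/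
private theorem memLp_uncurry_reflect₈ {E' : Type*} [NormedAddCommGroup E'] {t₀ : ℝ} {p : ℝ≥0∞}
    {F : ℝ → UnitAddTorus d → E'} (hF : MemLp (uncurry F) p (((volume : Measure ℝ).restrict (Ioo 0 t₀)).prod volume)) :
    MemLp (uncurry fun σ => F (t₀ - σ)) p (((volume : Measure ℝ).restrict (Ioo 0 t₀)).prod volume) := by
  have e : (uncurry fun σ => F (t₀ - σ)) = uncurry F ∘ fun p : ℝ × UnitAddTorus d => (t₀ - p.1, p.2) := by
    funext p; rfl
  rw [e]
  exact hF.comp_measurePreserving (measurePreserving_reflect_slab₈ t₀)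

/-- A flat weak solution lies in `L²` of its slab. [cite: DiPernaLions1989, §II.1 (12)–(14)]
-- adapted from `Literature/Analysis/FluidPDE/PassiveVectorTensorEnergyEquality.lean` (inline there) -/
private theorem memLp_two_uncurry_slab₈ {A T : ℝ} {𝔸 : Visc4 d} {b w : ℝ → UnitAddTorus d → EuclideanSpace ℝ d}
    {w₀ : UnitAddTorus d → EuclideanSpace ℝ d} (h : IsWeakTensorPassiveVectorOn A T 𝔸 b w₀ w) :
    MemLp (uncurry w) 2 (((volume : Measure ℝ).restrict (Ioo 0 T)).prod volume) := by
  have hwm := h.aestronglyMeasurable_uncurry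
  obtain ⟨C, hC⟩ := h.ae_lintegral_sq_le
  refine ⟨hwm, ?_⟩
  rw [eLpNorm_lt_top_iff_lintegral_rpow_enorm_lt_top two_ne_zero ENNReal.ofNat_ne_top, ENNReal.toReal_ofNat]
  have e : ∫⁻ p, ‖uncurry w p‖ₑ ^ (2 : ℝ) ∂(((volume : Measure ℝ).restrict (Ioo 0 T)).prod volume) =
      ∫⁻ p, ‖uncurry w p‖ₑ ^ 2 ∂(((volume : Measure ℝ).restrict (Ioo 0 T)).prod volume) :=
    lintegral_congr fun p => by rw [ENNReal.rpow_two]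
  rw [e, lintegral_prod _ (hwm.enorm.pow_const 2)]
  calc ∫⁻ t in Ioo 0 T, ∫⁻ x, ‖uncurry w (t, x)‖ₑ ^ 2
      ≤ ∫⁻ _ in Ioo 0 T, (C : ℝ≥0∞) := lintegral_mono_ae (hC.mono fun t ht => ht)
    _ < ⊤ := by
        rw [lintegral_const, Measure.restrict_apply_univ]
        exact ENNReal.mul_lt_top ENNReal.coe_lt_top measure_Ioo_lt_top


end Slices

/-! ## §4 The two-problem duality in physical form -/

section Physical

namespace IsWeakTensorPassiveVectorOn

variable {T t₀ : ℝ} {𝔸₁ 𝔸₂ : Visc4 d} {b₁ b₂ u ψ : ℝ → UnitAddTorus d → EuclideanSpace ℝ d}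
  {u₀ φ : UnitAddTorus d → EuclideanSpace ℝ d}

/-- **TWO-PROBLEM DUALITY, PHYSICAL FORM.** Under the hypotheses of `twoProblemDuality_traces` verbatim
(`u` a weak solution of problem 1 on `(0,T)`; `ψ` a weak solution of the adjoint of problem 2 written
forward on `(0,t₀)`, `0 < t₀ ≤ T`; Legendre–Hadamard tensors with `lo > 0`; essentially bounded carriers;
`L²` weakly solenoidal data; continuous representatives `g` of `t ↦ ∫⟪u(t), φ⟫` and `h` of `r ↦ ∫⟪ψ(r), u₀⟫`)
there are space–time `L²` WEAK GRADIENTS `Du` of `u` on `(0,T)` and `Dψ` of `ψ` on `(0,t₀)` (a.e. slice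
weak partial derivatives) such that

  `g t₀ − h t₀ = ∫_{σ ∈ (0,t₀]} ( Σⱼ ∫ ⟪(b₁ σ x j − b₂ σ x j) • u σ x, Dψ (t₀−σ) j x⟫ dx`
  `                              − ∫ Σ_{l,i,c,e} (𝔸₁ − 𝔸₂) i c l e (Dψ (t₀−σ) c x)_i (Du σ e x)_l dx ) dσ`,

with the density AND each of its two summands integrable on `(0,t₀)` — the TRANSPORT cross term (carrier difference on the solution,
derivative on the test) and the VISCOUS cross term (tensor difference between the two weak gradients, test
gradient in the `(c,i)` slots, solution gradient in the `(e,l)` slots). Proof: `twoProblemDuality_traces`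
(modewise) + `hasSum_crossDensity_physical` at a.e. `σ` (the slices are `L²` with `L²` weak gradients for a.e.
time; the carriers are a.e. bounded). [cite: Temam1984, Ch. III §1 Lemma 1.2 and Lemma 1.4]
[cite: KuksinShirikyan2012, Prop. 2.1.7 (2.11)] [cite: Frisch1995Turbulence, §9.6.3 eq. (9.57) p. 233] -/
theorem twoProblemDuality_physical (hu : IsWeakTensorPassiveVectorOn 0 T 𝔸₁ b₁ u₀ u)
    (ht₀ : 0 < t₀) (ht₀T : t₀ ≤ T)
    (hψ : IsWeakTensorPassiveVectorOn 0 t₀ (majorTranspose 𝔸₂) (fun r => -b₂ (t₀ - r)) φ ψ)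
    {lo hi : ℝ} (h𝔸₁ : NearIso 𝔸₁ lo hi) (h𝔸₂ : NearIso 𝔸₂ lo hi) (hlo : 0 < lo)
    (hu₀ : MemLp u₀ 2 volume) (hdivu₀ : FunctionSpaces.Torus.IsWeaklyDivFree u₀)
    (hφ : MemLp φ 2 volume) (hdivφ : FunctionSpaces.Torus.IsWeaklyDivFree φ)
    (hb₁ : MemLp (FunctionSpaces.Torus.stLift b₁) ∞ (volume.restrict (Ioo 0 T ×ˢ univ)))
    (hb₂ : MemLp (FunctionSpaces.Torus.stLift b₂) ∞ (volume.restrict (Ioo 0 T ×ˢ univ)))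
    {g h : ℝ → ℝ} (hgc : ContinuousOn g (Icc 0 T))
    (hg : ∀ᵐ t ∂(volume.restrict (Ioo 0 T)), ∫ x, ⟪u t x, φ x⟫_ℝ = g t)
    (hhc : ContinuousOn h (Icc 0 t₀))
    (hh : ∀ᵐ r ∂(volume.restrict (Ioo 0 t₀)), ∫ x, ⟪ψ r x, u₀ x⟫_ℝ = h r) :
    ∃ (Du : ℝ → d → UnitAddTorus d → EuclideanSpace ℝ d) (Dψ : ℝ → d → UnitAddTorus d → EuclideanSpace ℝ d),
      (∀ c, MemLp (uncurry (Du · c)) 2 (((volume : Measure ℝ).restrict (Ioo 0 T)).prod volume)) ∧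
      (∀ᵐ t ∂(volume.restrict (Ioo 0 T)), ∀ c, FunctionSpaces.Torus.HasWeakPartialDeriv c (u t) (Du t c)) ∧
      (∀ c, MemLp (uncurry (Dψ · c)) 2 (((volume : Measure ℝ).restrict (Ioo 0 t₀)).prod volume)) ∧
      (∀ᵐ r ∂(volume.restrict (Ioo 0 t₀)), ∀ c, FunctionSpaces.Torus.HasWeakPartialDeriv c (ψ r) (Dψ r c)) ∧
      IntegrableOn (fun σ => (∑ j, ∫ x, ⟪(b₁ σ x j - b₂ σ x j) • u σ x, Dψ (t₀ - σ) j x⟫_ℝ) -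
          ∫ x, ∑ l, ∑ i, ∑ c, ∑ e, (𝔸₁ - 𝔸₂) i c l e * (Dψ (t₀ - σ) c x) i * (Du σ e x) l)
        (Ioo 0 t₀) volume ∧
      IntegrableOn (fun σ => ∑ j, ∫ x, ⟪(b₁ σ x j - b₂ σ x j) • u σ x, Dψ (t₀ - σ) j x⟫_ℝ) (Ioc 0 t₀) volume ∧
      IntegrableOn (fun σ => ∫ x, ∑ l, ∑ i, ∑ c, ∑ e, (𝔸₁ - 𝔸₂) i c l e * (Dψ (t₀ - σ) c x) i * (Du σ e x) l)
        (Ioc 0 t₀) volume ∧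
      g t₀ - h t₀ = ∫ σ in Ioc 0 t₀,
        ((∑ j, ∫ x, ⟪(b₁ σ x j - b₂ σ x j) • u σ x, Dψ (t₀ - σ) j x⟫_ℝ) -
          ∫ x, ∑ l, ∑ i, ∑ c, ∑ e, (𝔸₁ - 𝔸₂) i c l e * (Dψ (t₀ - σ) c x) i * (Du σ e x) l) := by
  -- the weak gradients of the two members
  have hDu : ∫⁻ t in Ioo 0 T, FunctionSpaces.Torus.eGradNormSq (u t) ≠ ∞ := by
    have hE := eVectorDissipation_lt_top hu h𝔸₁ hlo hu₀ hdivu₀ hb₁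
    unfold eVectorDissipation at hE
    have hlo' : ENNReal.ofReal lo ≠ 0 := by
      rw [ne_eq, ENNReal.ofReal_eq_zero, not_le]; exact hlo
    intro htop
    rw [htop, ENNReal.mul_top hlo'] at hE
    exact lt_irrefl _ hE
  have h𝔸₂' : NearIso (majorTranspose 𝔸₂) lo hi := (nearIso_majorTranspose_iff 𝔸₂ lo hi).2 h𝔸₂
  have hb₂' : MemLp (FunctionSpaces.Torus.stLift (fun r => -b₂ (t₀ - r))) ∞ (volume.restrict (Ioo 0 t₀ ×ˢ univ)) :=
    memLp_top_stLift_reversed hb₂ ht₀T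
  have hDψ : ∫⁻ r in Ioo 0 t₀, FunctionSpaces.Torus.eGradNormSq (ψ r) ≠ ∞ := by
    have hE := eVectorDissipation_lt_top hψ h𝔸₂' hlo hφ hdivφ hb₂'
    unfold eVectorDissipation at hE
    have hlo' : ENNReal.ofReal lo ≠ 0 := by
      rw [ne_eq, ENNReal.ofReal_eq_zero, not_le]; exact hlo
    intro htop
    rw [htop, ENNReal.mul_top hlo'] at hE
    exact lt_irrefl _ hE
  obtain ⟨Du, hDu2, hDuw⟩ := exists_weakGradient_of_lintegral_eGradNormSq_ne_top hu.aestronglyMeasurable_uncurry hu.ae_memLp_two hDu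
  obtain ⟨Dψ, hDψ2, hDψw⟩ := exists_weakGradient_of_lintegral_eGradNormSq_ne_top hψ.aestronglyMeasurable_uncurry hψ.ae_memLp_two hDψ
  -- the modewise identity
  obtain ⟨G, hGint, hGsum, c, -, hg', hh'⟩ :=
    hu.exists_integrableOn_hasSum_cross_sub_traces ht₀ ht₀T hψ h𝔸₁ h𝔸₂ hlo hu₀ hdivu₀ hφ hdivφ hb₁ hb₂
  have e1 := hg' g hgc hg
  have e2 := hh' h hhc hh
  -- slice facts at a.e. `σ ∈ (0,t₀)`: member 1 restricted from `(0,T)`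
  have hsub : Ioo 0 t₀ ⊆ Ioo 0 T := Ioo_subset_Ioo_right ht₀T
  have hu2 : ∀ᵐ σ ∂(volume.restrict (Ioo 0 t₀)), MemLp (u σ) 2 volume :=
    ae_restrict_of_ae_restrict_of_subset hsub hu.ae_memLp_two
  have hDuσ : ∀ᵐ σ ∂(volume.restrict (Ioo 0 t₀)), ∀ c, MemLp (Du σ c) 2 volume := by
    have h' : ∀ c, ∀ᵐ σ ∂(volume.restrict (Ioo 0 T)), MemLp (Du σ c) 2 volume := fun c =>
      ae_memLp_two_slice_of_memLp_prod₈ (f := uncurry (Du · c)) (hDu2 c)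
    exact ae_restrict_of_ae_restrict_of_subset hsub ((ae_all_iff.2 h'))
  have hDuwσ : ∀ᵐ σ ∂(volume.restrict (Ioo 0 t₀)), ∀ c, FunctionSpaces.Torus.HasWeakPartialDeriv c (u σ) (Du σ c) :=
    ae_restrict_of_ae_restrict_of_subset hsub hDuw
  -- member 2 read at `t₀ − σ`
  have hψ2 : ∀ᵐ σ ∂(volume.restrict (Ioo 0 t₀)), MemLp (ψ (t₀ - σ)) 2 volume :=
    ae_restrict_Ioo_reflect₈ (P := fun r => MemLp (ψ r) 2 volume) hψ.ae_memLp_two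
  have hDψσ : ∀ᵐ σ ∂(volume.restrict (Ioo 0 t₀)), ∀ c, MemLp (Dψ (t₀ - σ) c) 2 volume := by
    have h' : ∀ c, ∀ᵐ r ∂(volume.restrict (Ioo 0 t₀)), MemLp (Dψ r c) 2 volume := fun c =>
      ae_memLp_two_slice_of_memLp_prod₈ (f := uncurry (Dψ · c)) (hDψ2 c)
    exact ae_restrict_Ioo_reflect₈ (P := fun r => ∀ c, MemLp (Dψ r c) 2 volume) (ae_all_iff.2 h')
  have hDψwσ : ∀ᵐ σ ∂(volume.restrict (Ioo 0 t₀)), ∀ c, FunctionSpaces.Torus.HasWeakPartialDeriv c (ψ (t₀ - σ)) (Dψ (t₀ - σ) c) :=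
    ae_restrict_Ioo_reflect₈ (P := fun r => ∀ c, FunctionSpaces.Torus.HasWeakPartialDeriv c (ψ r) (Dψ r c)) hDψw
  -- the carriers are a.e. bounded on a.e. slice
  obtain ⟨C₁, -, hC₁⟩ := ae_ae_norm_le_of_memLp_top_stLift hb₁
  obtain ⟨C₂, -, hC₂⟩ := ae_ae_norm_le_of_memLp_top_stLift hb₂
  have hC₁' : ∀ᵐ σ ∂(volume.restrict (Ioo 0 t₀)), ∀ᵐ x ∂volume, ‖b₁ σ x‖ ≤ C₁ :=
    ae_restrict_of_ae_restrict_of_subset hsub hC₁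
  have hC₂' : ∀ᵐ σ ∂(volume.restrict (Ioo 0 t₀)), ∀ᵐ x ∂volume, ‖b₂ σ x‖ ≤ C₂ :=
    ae_restrict_of_ae_restrict_of_subset hsub hC₂
  have hbm₁ : ∀ᵐ σ ∂(volume.restrict (Ioo 0 t₀)), AEStronglyMeasurable (b₁ σ) volume :=
    ae_restrict_of_ae_restrict_of_subset hsub (hu.ae_aestronglyMeasurable_slice.mono fun t ht => ht.2)
  have hbm₂ : ∀ᵐ σ ∂(volume.restrict (Ioo 0 t₀)), AEStronglyMeasurable (b₂ σ) volume := by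
    -- the adjoint class sees the carrier `r ↦ −b₂(t₀ − r)`; reflect and negate
    have h' : ∀ᵐ r ∂(volume.restrict (Ioo 0 t₀)), AEStronglyMeasurable (fun x => -b₂ (t₀ - r) x) volume :=
      hψ.ae_aestronglyMeasurable_slice.mono fun r hr => hr.2
    have h'' := ae_restrict_Ioo_reflect₈ (P := fun r => AEStronglyMeasurable (fun x => -b₂ (t₀ - r) x) volume) h'
    filter_upwards [h''] with σ hσ
    have e : (fun x => -b₂ (t₀ - (t₀ - σ)) x) = fun x => -b₂ σ x := by
      funext x; rw [sub_sub_cancel]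
    rw [e] at hσ
    exact hσ.neg.congr (ae_of_all _ fun x => by simp)
  -- the physical density at a.e. time
  have hphys : ∀ᵐ σ ∂(volume.restrict (Ioo 0 t₀)), G σ =
      (∑ j, ∫ x, ⟪(b₁ σ x j - b₂ σ x j) • u σ x, Dψ (t₀ - σ) j x⟫_ℝ) -
        ∫ x, ∑ l, ∑ i, ∑ c, ∑ e, (𝔸₁ - 𝔸₂) i c l e * (Dψ (t₀ - σ) c x) i * (Du σ e x) l := by
    filter_upwards [hGsum, hu2, hDuσ, hDuwσ, hψ2, hDψσ, hDψwσ, hC₁', hC₂', hbm₁, hbm₂]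
      with σ hGσ hu2σ hDuσ' hDuwσ' hψ2σ hDψσ' hDψwσ' hC₁σ hC₂σ hbm₁σ hbm₂σ
    have haw : ∀ j, MemLp (fun z => (b₁ σ z j - b₂ σ z j) • u σ z) 2 volume := by
      intro j
      refine memLp_smul_of_ae_bound (a := fun z => b₁ σ z j - b₂ σ z j) ?_ (M := C₁ + C₂) ?_ hu2σ
      · exact ((PiLp.continuous_apply 2 _ j).comp_aestronglyMeasurable hbm₁σ).sub
          ((PiLp.continuous_apply 2 _ j).comp_aestronglyMeasurable hbm₂σ)
      · filter_upwards [hC₁σ, hC₂σ] with x hx₁ hx₂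
        calc |b₁ σ x j - b₂ σ x j| ≤ |b₁ σ x j| + |b₂ σ x j| := abs_sub _ _
          _ ≤ ‖b₁ σ x‖ + ‖b₂ σ x‖ := add_le_add
              ((Real.norm_eq_abs _).symm.le.trans (PiLp.norm_apply_le (b₁ σ x) j))
              ((Real.norm_eq_abs _).symm.le.trans (PiLp.norm_apply_le (b₂ σ x) j))
          _ ≤ C₁ + C₂ := add_le_add hx₁ hx₂
    have hP := hasSum_crossDensity_physical 𝔸₁ 𝔸₂ (a := fun j z => b₁ σ z j - b₂ σ z j)
      hu2σ hψ2σ hDuσ' hDψσ' hDuwσ' hDψwσ' haw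
    exact (hGσ.unique hP)
  have hphys' : ∀ᵐ σ ∂(volume.restrict (Ioc 0 t₀)), G σ =
      (∑ j, ∫ x, ⟪(b₁ σ x j - b₂ σ x j) • u σ x, Dψ (t₀ - σ) j x⟫_ℝ) -
        ∫ x, ∑ l, ∑ i, ∑ c, ∑ e, (𝔸₁ - 𝔸₂) i c l e * (Dψ (t₀ - σ) c x) i * (Du σ e x) l := by
    rw [← Measure.restrict_congr_set (Ioo_ae_eq_Ioc (μ := (volume : Measure ℝ)) (a := (0 : ℝ)) (b := t₀))]
    exact hphys
  -- integrability of each cross summand on the slab `(0,t₀) × 𝕋^d`, hence of its space integral in `σ`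
  set μ₀ : Measure (ℝ × UnitAddTorus d) := ((volume : Measure ℝ).restrict (Ioo 0 t₀)).prod volume with hμ₀
  have hle : μ₀ ≤ ((volume : Measure ℝ).restrict (Ioo 0 T)).prod volume := slab_le_slab₈ hsub
  have huμ : MemLp (uncurry u) 2 μ₀ := (memLp_two_uncurry_slab₈ hu).mono_measure hle
  have hDuμ : ∀ e, MemLp (uncurry (Du · e)) 2 μ₀ := fun e => (hDu2 e).mono_measure hle
  have hDψμ : ∀ c, MemLp (uncurry fun σ => Dψ (t₀ - σ) c) 2 μ₀ := fun c => memLp_uncurry_reflect₈ (hDψ2 c)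
  have hbμ : ∀ {b : ℝ → UnitAddTorus d → EuclideanSpace ℝ d},
      MemLp (FunctionSpaces.Torus.stLift b) ∞ (volume.restrict (Ioo 0 T ×ˢ univ)) →
      AEStronglyMeasurable (uncurry b) μ₀ ∧ ∃ C : ℝ, 0 ≤ C ∧ ∀ᵐ q ∂μ₀, ‖b q.1 q.2‖ ≤ C := by
    intro b hb
    obtain ⟨C, hC0, hC⟩ := ae_norm_le_prod_of_memLp_top_stLift hb
    have hm : AEStronglyMeasurable (uncurry b) (((volume : Measure ℝ).restrict (Ioo 0 T)).prod volume) := by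
      rw [← volume_restrict_prod_eq]
      exact FunctionSpaces.Torus.aestronglyMeasurable_uncurry_of_stLift_restrict hb.1
    exact ⟨hm.mono_measure hle, C, hC0, hC.filter_mono (ae_mono hle)⟩
  obtain ⟨hb₁m, M₁, hM₁0, hM₁⟩ := hbμ hb₁
  obtain ⟨hb₂m, M₂, hM₂0, hM₂⟩ := hbμ hb₂
  -- transport summand, one coordinate at a time
  have hIT : ∀ j, Integrable (fun q : ℝ × UnitAddTorus d =>
      ⟪(b₁ q.1 q.2 j - b₂ q.1 q.2 j) • u q.1 q.2, Dψ (t₀ - q.1) j q.2⟫_ℝ) μ₀ := by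
    intro j
    have hcoef : AEStronglyMeasurable (fun q : ℝ × UnitAddTorus d => b₁ q.1 q.2 j - b₂ q.1 q.2 j) μ₀ :=
      ((PiLp.continuous_apply 2 _ j).comp_aestronglyMeasurable hb₁m).sub
        ((PiLp.continuous_apply 2 _ j).comp_aestronglyMeasurable hb₂m)
    have hm : AEStronglyMeasurable (fun q : ℝ × UnitAddTorus d =>
        ⟪(b₁ q.1 q.2 j - b₂ q.1 q.2 j) • u q.1 q.2, Dψ (t₀ - q.1) j q.2⟫_ℝ) μ₀ :=
      (hcoef.smul huμ.1).inner (hDψμ j).1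
    have hdom : Integrable (fun q : ℝ × UnitAddTorus d => (M₁ + M₂) * (‖uncurry u q‖ * ‖uncurry (fun σ => Dψ (t₀ - σ) j) q‖)) μ₀ :=
      (huμ.norm.integrable_mul (hDψμ j).norm).const_mul (M₁ + M₂)
    refine hdom.mono' hm ?_
    filter_upwards [hM₁, hM₂] with q h1 h2
    calc ‖⟪(b₁ q.1 q.2 j - b₂ q.1 q.2 j) • u q.1 q.2, Dψ (t₀ - q.1) j q.2⟫_ℝ‖
        ≤ ‖(b₁ q.1 q.2 j - b₂ q.1 q.2 j) • u q.1 q.2‖ * ‖Dψ (t₀ - q.1) j q.2‖ := norm_inner_le_norm _ _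
      _ = |b₁ q.1 q.2 j - b₂ q.1 q.2 j| * (‖u q.1 q.2‖ * ‖Dψ (t₀ - q.1) j q.2‖) := by
          rw [norm_smul, Real.norm_eq_abs, mul_assoc]
      _ ≤ (M₁ + M₂) * (‖u q.1 q.2‖ * ‖Dψ (t₀ - q.1) j q.2‖) := by
          refine mul_le_mul_of_nonneg_right ?_ (by positivity)
          calc |b₁ q.1 q.2 j - b₂ q.1 q.2 j| ≤ |b₁ q.1 q.2 j| + |b₂ q.1 q.2 j| := abs_sub _ _
            _ ≤ ‖b₁ q.1 q.2‖ + ‖b₂ q.1 q.2‖ := add_le_add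
                ((Real.norm_eq_abs _).symm.le.trans (PiLp.norm_apply_le (b₁ q.1 q.2) j))
                ((Real.norm_eq_abs _).symm.le.trans (PiLp.norm_apply_le (b₂ q.1 q.2) j))
            _ ≤ M₁ + M₂ := add_le_add h1 h2
      _ = (M₁ + M₂) * (‖uncurry u q‖ * ‖uncurry (fun σ => Dψ (t₀ - σ) j) q‖) := rfl
  have hITσ : IntegrableOn (fun σ => ∑ j, ∫ x, ⟪(b₁ σ x j - b₂ σ x j) • u σ x, Dψ (t₀ - σ) j x⟫_ℝ) (Ioc 0 t₀) volume := by
    rw [integrableOn_Ioc_iff_integrableOn_Ioo]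
    exact integrable_finsetSum _ fun j _ => (hIT j).integral_prod_left
  -- viscous summand
  have hIV : Integrable (fun q : ℝ × UnitAddTorus d =>
      ∑ l, ∑ i, ∑ c, ∑ e, (𝔸₁ - 𝔸₂) i c l e * (Dψ (t₀ - q.1) c q.2) i * (Du q.1 e q.2) l) μ₀ := by
    refine integrable_finsetSum _ fun l _ => integrable_finsetSum _ fun i _ => integrable_finsetSum _ fun c _ =>
      integrable_finsetSum _ fun e _ => ?_
    have h := (((hDψμ c).eval_piLp i).integrable_mul ((hDuμ e).eval_piLp l)).const_mul ((𝔸₁ - 𝔸₂) i c l e)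
    refine h.congr (ae_of_all _ fun q => ?_)
    simp only [Pi.mul_apply, uncurry]
    ring
  have hIVσ : IntegrableOn (fun σ => ∫ x, ∑ l, ∑ i, ∑ c, ∑ e, (𝔸₁ - 𝔸₂) i c l e * (Dψ (t₀ - σ) c x) i * (Du σ e x) l)
      (Ioc 0 t₀) volume := by
    rw [integrableOn_Ioc_iff_integrableOn_Ioo]
    exact hIV.integral_prod_left
  refine ⟨Du, Dψ, hDu2, hDuw, hDψ2, hDψw, hGint.congr_fun_ae hphys, hITσ, hIVσ, ?_⟩
  rw [e1, e2, ← integral_congr_ae hphys']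
  ring

/-- **The physical two-problem duality, SPLIT form**: `g t₀ − h t₀ = (∫ transport cross) − (∫ viscous cross)`
(both summands integrable on `(0,t₀]`). [cite: Temam1984, Ch. III §1 Lemma 1.2 and Lemma 1.4] -/
theorem twoProblemDuality_physical_split (hu : IsWeakTensorPassiveVectorOn 0 T 𝔸₁ b₁ u₀ u)
    (ht₀ : 0 < t₀) (ht₀T : t₀ ≤ T)
    (hψ : IsWeakTensorPassiveVectorOn 0 t₀ (majorTranspose 𝔸₂) (fun r => -b₂ (t₀ - r)) φ ψ)
    {lo hi : ℝ} (h𝔸₁ : NearIso 𝔸₁ lo hi) (h𝔸₂ : NearIso 𝔸₂ lo hi) (hlo : 0 < lo)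
    (hu₀ : MemLp u₀ 2 volume) (hdivu₀ : FunctionSpaces.Torus.IsWeaklyDivFree u₀)
    (hφ : MemLp φ 2 volume) (hdivφ : FunctionSpaces.Torus.IsWeaklyDivFree φ)
    (hb₁ : MemLp (FunctionSpaces.Torus.stLift b₁) ∞ (volume.restrict (Ioo 0 T ×ˢ univ)))
    (hb₂ : MemLp (FunctionSpaces.Torus.stLift b₂) ∞ (volume.restrict (Ioo 0 T ×ˢ univ)))
    {g h : ℝ → ℝ} (hgc : ContinuousOn g (Icc 0 T))
    (hg : ∀ᵐ t ∂(volume.restrict (Ioo 0 T)), ∫ x, ⟪u t x, φ x⟫_ℝ = g t)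
    (hhc : ContinuousOn h (Icc 0 t₀))
    (hh : ∀ᵐ r ∂(volume.restrict (Ioo 0 t₀)), ∫ x, ⟪ψ r x, u₀ x⟫_ℝ = h r) :
    ∃ (Du : ℝ → d → UnitAddTorus d → EuclideanSpace ℝ d) (Dψ : ℝ → d → UnitAddTorus d → EuclideanSpace ℝ d),
      (∀ c, MemLp (uncurry (Du · c)) 2 (((volume : Measure ℝ).restrict (Ioo 0 T)).prod volume)) ∧
      (∀ᵐ t ∂(volume.restrict (Ioo 0 T)), ∀ c, FunctionSpaces.Torus.HasWeakPartialDeriv c (u t) (Du t c)) ∧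
      (∀ c, MemLp (uncurry (Dψ · c)) 2 (((volume : Measure ℝ).restrict (Ioo 0 t₀)).prod volume)) ∧
      (∀ᵐ r ∂(volume.restrict (Ioo 0 t₀)), ∀ c, FunctionSpaces.Torus.HasWeakPartialDeriv c (ψ r) (Dψ r c)) ∧
      g t₀ - h t₀ =
        (∫ σ in Ioc 0 t₀, ∑ j, ∫ x, ⟪(b₁ σ x j - b₂ σ x j) • u σ x, Dψ (t₀ - σ) j x⟫_ℝ) -
          ∫ σ in Ioc 0 t₀, ∫ x, ∑ l, ∑ i, ∑ c, ∑ e, (𝔸₁ - 𝔸₂) i c l e * (Dψ (t₀ - σ) c x) i * (Du σ e x) l := by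
  obtain ⟨Du, Dψ, h1, h2, h3, h4, -, hI1, hI2, hX⟩ :=
    hu.twoProblemDuality_physical ht₀ ht₀T hψ h𝔸₁ h𝔸₂ hlo hu₀ hdivu₀ hφ hdivφ hb₁ hb₂ hgc hg hhc hh
  refine ⟨Du, Dψ, h1, h2, h3, h4, ?_⟩
  rw [hX, integral_sub hI1 hI2]

end IsWeakTensorPassiveVectorOn

end Physical

end Torus

end Literature.Analysis.FluidPDE

end
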